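import Literature.MathematicalPhysics.QuantumFieldTheory.Balaban1983to89.B4BoxCov237
import Literature.MathematicalPhysics.QuantumFieldTheory.Balaban1983to89.B6QGQLower276
import Literature.MathematicalPhysics.QuantumFieldTheory.Balaban1983to89.QGQInverse

/-!
# Beta / GAN24 / WoodburyFibreBoxQGQ — Bałaban's block-averaged propagator `Q_k G_k(□) Q_k^*` on a NEUMANN BOX at
`A = 0` is COERCIVE UNIFORMLY IN THE BLOCK SIDE: `Q_k G_k(□) Q_k^* ⪰ γ_B·1`, `γ_B = 1/(36^{d+1}(4(d+1) + m² + a))`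
(the box analogue of B6 (2.76) `Q′_jG′_jQ′_j* ≥ 2γ₀`; census row V9 part 2, input (B))

Cell `pub-balaban`, β sub-cell, BINDER ROW **G-an2-4 ∕ (CONV-C)** («NOT IN PRINT; our proof attempt»), prover part **P3 =
WOODBURY-FIBRE reduction** (lineage `b2b-balaban-gan24-p3`, gen 6).  HONEST FRAMING (verbatim): discharging `BetaPertH`
makes Bałaban's UV stability UNCONDITIONAL — a real constructive-QFT result; it is NOT the continuum limit and NOT the Clay
problem.  HONEST DEPENDENCY: continuum YM on T⁴ ⇐ BetaPertH ∧ nine spine estimates (0/9 proved); BetaPertH ⇐ (D1) ∧ (D4) ∧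
CAP+tail; G-an2-4 gates asym, D1 and NE2/3/4.  `[folklore]` finite-dimensional analysis; 0 sorry; nothing printed and nothing
programme-internal is used as a hypothesis; nothing of (CONV-C) ∕ `BetaPertH` is discharged here.

## What and why

The gauge-section operator of census row V9 is `Γ·coproj ℋ·Γ` (R17, `GAN24/WoodburyFibreGaugeSection.flucCov_sq_reg`), and
gen 5's assembly (`GAN24/WoodburyFibreGaugeCubeDecay.cubeDecay_flucCov_sq`) reduces its `N`-uniform cube decay to decay data of
the scalar fluctuation covariance `Γ` and minimiser `ℋ = G Q*(QGQ*)⁻¹`.  On Bałaban's Neumann boxes at `A = 0` the decay of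
`G = G_k(□)` for ALL scales is the tree theorem `B4Thm110ZeroBox.thm110_zero_box_roww_coeff`; the one missing scalar input is
a LOWER bound on the pivot `Q_kG_k(□)Q_k^*`, uniform in the block side `n = L^k`, which feeds the finite Combes–Thomas step
`B5Decay126.PosDecay.inv` for `(Q_kG_k(□)Q_k^*)⁻¹`.  B6 (2.76) [Balaban1984PropagatorsII, p. 236] prints such a bound for the
WHOLE lattice (tree: `B6QGQLower276.qGq_lower`, Fourier-free, via block bumps); this file proves the BOX version by the same
variational device, reusing B6QGQLower276's block bump `bump`, test function `F`, step bound `F_step_sq` and block mass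
`sum_B_bump` BY NAME, the box form `B4BoxCov237.quadFormR_eq`, and `QGQInverse.qgq_coercive_of_approx_right_inverse`.

## Main results (`n ≥ 1` fine points per unit length, `a > 0`, `m² ≥ 0`, box `Π_μ[0, M_μ)` of unit blocks, `M_μ ≥ 1`;
`G = (boxOpR n a m2 M)⁻¹`, `S = indB n M` the 0∕1 block-incidence matrix, so `Q_k = n^{−(d+1)}·S`, `Q_k^* = Sᵀ`)

* `boxOpR_eq_add_gram` : `boxOpR n a m2 M = boxOpR n 0 m2 M + (a/n^{d+1})·SᵀS`;
* `indB_mulVec_testVec` ∕ `testVec_energy_le` : the bump test vector has block sums `Θ·λ` (`(n/6)^{d+1} ≤ Θ ≤ n^{d+1}`)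
  and energy `≤ (4(d+1) + m² + a)·n^{d+1}·‖λ‖²`;
* **`sGs_coercive`** : `S·G·Sᵀ ⪰ n^{d+1}·γ_B`, and **`qGq_box_coercive`** : `n^{−(d+1)}·S·G·Sᵀ = Q_kG_k(□)Q_k^* ⪰ γ_B`,
  `γ_B = B6QGQLower276.gammaQ (d+1) (m² + a)` — the SAME constant as the tree's ℤ^d theorem; uniform in `n`, box, window.
-/

namespace Summit.QuantumFields.BalabanUV.Beta.GAN24.WoodburyFibreBoxQGQ

open Finset Matrix
open Literature.MathematicalPhysics.QuantumFieldTheory.Balaban1983to89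
open B4Reflection242 (boxDom mem_boxDom blk nbrs mem_nbrs card_nbrs blk_mem_boxDom)
open B4Green242Bridge (boxNbrs boxBlk mem_boxNbrs_comm card_boxNbrs)
open B4BoxCov237 (opBoxR boxOpR indB extB extB_of_mem quadFormR_eq indB_mulVec indB_mulVec_eq_chartSum
  filter_blk_eq_image card_filter_blk boxOpR_isSymm boxOpR_isUnit boxOpR_form_nonneg sum_boxNbrs_commR)
open B4Green244 (finePt)
open B6QGQLower276 (g1 Theta1 bump F F_step_sq sum_B sum_B_bump bump_nonneg bump_le_one Theta1_div_ge Theta1_div_le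
  Theta1_nonneg gammaQ gammaQ_pos)

noncomputable section

variable {d : ℕ}

/-! ## §1 The block-incidence matrix: Gram identities and the splitting of `boxOpR` -/

/-- abbreviation: the fine box `Π_μ[0, n·M_μ)` as a side function. [folklore] -/
abbrev fineN (n : ℕ) (M : Fin (d + 1) → ℕ) : Fin (d + 1) → ℕ := fun i => n * M i

/-- the block label of a fine box point, as a point of the unit box. [folklore] -/
def blkBox {n : ℕ} (hn : 1 ≤ n) (M : Fin (d + 1) → ℕ) (x : ↥(boxDom (fineN n M))) : ↥(boxDom M) :=
  ⟨blk n x.1, blk_mem_boxDom hn x.2⟩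

/-- the label of `blkBox x` is `blk n x`. [folklore] -/
@[simp] theorem blkBox_val {n : ℕ} (hn : 1 ≤ n) (M : Fin (d + 1) → ℕ) (x : ↥(boxDom (fineN n M))) :
    (blkBox hn M x).1 = blk n x.1 := rfl

/-- `indB n M y x = [blkBox x = y]`. [folklore] -/
theorem indB_apply {n : ℕ} (hn : 1 ≤ n) (M : Fin (d + 1) → ℕ) (y : ↥(boxDom M)) (x : ↥(boxDom (fineN n M))) :
    indB n M y x = if blkBox hn M x = y then 1 else 0 := by
  simp only [indB, Matrix.of_apply, Subtype.ext_iff, blkBox_val]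

/-- `(SᵀS)(x,x′) = [blk x = blk x′]`: the block term of `boxOpR` is the Gram matrix of the incidence matrix. [folklore] -/
theorem indB_transpose_mul_apply {n : ℕ} (hn : 1 ≤ n) (M : Fin (d + 1) → ℕ) (x x' : ↥(boxDom (fineN n M))) :
    ((indB n M)ᵀ * indB n M) x x' = if blk n x'.1 = blk n x.1 then 1 else 0 := by
  rw [Matrix.mul_apply]
  have hpt : ∀ y : ↥(boxDom M), (indB n M)ᵀ x y * indB n M y x'
      = if y = blkBox hn M x then (if blkBox hn M x' = blkBox hn M x then 1 else 0) else 0 := by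
    intro y
    rw [Matrix.transpose_apply, indB_apply hn, indB_apply hn]
    by_cases h : y = blkBox hn M x
    · subst h; simp
    · have h' : blkBox hn M x ≠ y := fun e => h e.symm
      simp [h, h']
  simp_rw [hpt]
  rw [Finset.sum_ite_eq' Finset.univ (blkBox hn M x), if_pos (Finset.mem_univ _)]
  simp only [Subtype.ext_iff, blkBox_val]

/-- **SPLITTING** `boxOpR n a m2 M = boxOpR n 0 m2 M + (a/n^{d+1})·SᵀS`. [folklore] -/
theorem boxOpR_eq_add_gram {n : ℕ} (hn : 1 ≤ n) (a m2 : ℝ) (M : Fin (d + 1) → ℕ) :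
    boxOpR n a m2 M = boxOpR n 0 m2 M + (a * (((n : ℝ)) ^ (d + 1))⁻¹) • ((indB n M)ᵀ * indB n M) := by
  ext x x'
  rw [Matrix.add_apply, Matrix.smul_apply, indB_transpose_mul_apply hn, smul_eq_mul]
  simp only [boxOpR, opBoxR, Matrix.of_apply, B4Reflection242.avgK, zero_mul]
  split_ifs <;> ring

/-- each block of the fine box has `n^{d+1}` points (the fibre of `blkBox`). [folklore] -/
theorem card_fibre_blkBox {n : ℕ} (hn : 1 ≤ n) (M : Fin (d + 1) → ℕ) (y : ↥(boxDom M)) :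
    (Finset.univ.filter fun x : ↥(boxDom (fineN n M)) => blkBox hn M x = y).card = n ^ (d + 1) := by
  have hset : (Finset.univ.filter fun x : ↥(boxDom (fineN n M)) => blkBox hn M x = y)
      = Finset.univ.filter fun x : ↥(boxDom (fun i => n * M i)) => blk n x.1 = y.1 := by
    ext x; simp only [Finset.mem_filter, Finset.mem_univ, true_and, Subtype.ext_iff, blkBox_val]
  rw [hset, card_filter_blk hn M y]

/-- summing a function of the block label over the fine box: `Σ_x f(blk x) = n^{d+1}·Σ_y f y`. [folklore] -/
theorem sum_comp_blkBox {n : ℕ} (hn : 1 ≤ n) (M : Fin (d + 1) → ℕ) (f : ↥(boxDom M) → ℝ) :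
    ∑ x : ↥(boxDom (fineN n M)), f (blkBox hn M x) = (n : ℝ) ^ (d + 1) * ∑ y, f y := by
  rw [← Finset.sum_fiberwise Finset.univ (blkBox hn M) fun x => f (blkBox hn M x), Finset.mul_sum]
  refine Finset.sum_congr rfl fun y _ => ?_
  rw [Finset.sum_congr rfl fun x hx => by rw [(Finset.mem_filter.1 hx).2], Finset.sum_const, nsmul_eq_mul,
    card_fibre_blkBox hn M y]
  push_cast; ring

/-! ## §2 The bump test vector (B6QGQLower276's block bump, read on the box) and its block sums -/

/-- dictionary: B6QGQLower276's block label for side `side k = k + 1` is the box lineage's `blk (k+1)`. [folklore] -/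
theorem blk6_eq (k : ℕ) (p : Fin (d + 1) → ℤ) : B6QGQLower276.blk k p = blk (k + 1) p := by
  funext i; simp [B6QGQLower276.blk, B4Reflection242.blk, B6QGQLower276.side]

/-- dictionary: B6QGQLower276's block chart is the box lineage's `finePt (k+1)`. [folklore] -/
theorem chart6_eq (k : ℕ) (y : Fin (d + 1) → ℤ) (j : Fin (d + 1) → Fin (k + 1)) :
    B6QGQLower276.chart k y j = finePt (k + 1) y j := by
  funext i; simp [B6QGQLower276.chart, finePt, B6QGQLower276.side]

/-- the block mass `Θ = Θ₁^{d+1}` of the bump (`Θ₁ = B6QGQLower276.Theta1 (n−1)`, the one-dimensional profile sum for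
side `n`). [folklore] -/
def ThetaB (d n : ℕ) : ℝ := Theta1 (n - 1) ^ (d + 1)

/-- `(n/6)^{d+1} ≤ Θ`. [folklore] -/
theorem ThetaB_ge {n : ℕ} (hn : 1 ≤ n) : ((n : ℝ) / 6) ^ (d + 1) ≤ ThetaB d n := by
  obtain ⟨k, rfl⟩ : ∃ k, n = k + 1 := ⟨n - 1, by omega⟩
  have h := Theta1_div_ge k
  have hk : (0 : ℝ) < (k : ℝ) + 1 := by positivity
  simp only [ThetaB, Nat.add_sub_cancel]
  apply pow_le_pow_left₀ (by positivity)
  rw [le_div_iff₀ hk] at h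
  push_cast; linarith

/-- `Θ ≤ n^{d+1}`. [folklore] -/
theorem ThetaB_le {n : ℕ} (hn : 1 ≤ n) : ThetaB d n ≤ (n : ℝ) ^ (d + 1) := by
  obtain ⟨k, rfl⟩ : ∃ k, n = k + 1 := ⟨n - 1, by omega⟩
  have h := Theta1_div_le k
  have hk : (0 : ℝ) < (k : ℝ) + 1 := by positivity
  simp only [ThetaB, Nat.add_sub_cancel]
  apply pow_le_pow_left₀ (Theta1_nonneg k)
  rw [div_le_iff₀ hk] at h
  push_cast; linarith

/-- `0 < Θ`. [folklore] -/
theorem ThetaB_pos {n : ℕ} (hn : 1 ≤ n) : 0 < ThetaB d n := by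
  have hn' : (0 : ℝ) < n := by exact_mod_cast hn
  exact lt_of_lt_of_le (by positivity) (ThetaB_ge hn)

/-- **THE TEST VECTOR** `v_λ(x) = λ(blk x)·bump(x)` on the fine box: B6QGQLower276's `F` with the block profile `λ`
extended by zero off the unit box. [folklore] -/
def testVec (n : ℕ) (M : Fin (d + 1) → ℕ) (lam : ↥(boxDom M) → ℝ) : ↥(boxDom (fineN n M)) → ℝ :=
  fun x => F (n - 1) (extB M lam) x.1

/-- pointwise: `v_λ(x) = λ(blkBox x)·bump(x)`. [folklore] -/
theorem testVec_apply {n : ℕ} (hn : 1 ≤ n) (M : Fin (d + 1) → ℕ) (lam : ↥(boxDom M) → ℝ)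
    (x : ↥(boxDom (fineN n M))) : testVec n M lam x = lam (blkBox hn M x) * bump (n - 1) x.1 := by
  obtain ⟨k, rfl⟩ : ∃ k, n = k + 1 := ⟨n - 1, by omega⟩
  simp only [testVec, F, Nat.add_sub_cancel, blk6_eq]
  rw [show extB M lam (blk (k + 1) x.1) = lam (blkBox hn M x) from extB_of_mem lam (blkBox hn M x).2]

/-- `|v_λ(x)| ≤ |λ(blkBox x)|` (the bump takes values in `[0, 1]`). [folklore] -/
theorem abs_testVec_le {n : ℕ} (hn : 1 ≤ n) (M : Fin (d + 1) → ℕ) (lam : ↥(boxDom M) → ℝ)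
    (x : ↥(boxDom (fineN n M))) : |testVec n M lam x| ≤ |lam (blkBox hn M x)| := by
  rw [testVec_apply hn, abs_mul, abs_of_nonneg (bump_nonneg _ _)]
  exact mul_le_of_le_one_right (abs_nonneg _) (bump_le_one _ _)

/-- **BLOCK SUMS OF THE TEST VECTOR**: `S v_λ = Θ·λ`. [folklore] -/
theorem indB_mulVec_testVec {n : ℕ} (hn : 1 ≤ n) (M : Fin (d + 1) → ℕ) (lam : ↥(boxDom M) → ℝ) :
    indB n M *ᵥ testVec n M lam = ThetaB d n • lam := by
  obtain ⟨k, rfl⟩ : ∃ k, n = k + 1 := ⟨n - 1, by omega⟩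
  funext y
  rw [indB_mulVec_eq_chartSum hn, Pi.smul_apply, smul_eq_mul]
  have hpt : ∀ j : Fin (d + 1) → Fin (k + 1), extB (fun i => (k + 1) * M i) (testVec (k + 1) M lam) (finePt (k + 1) y.1 j)
      = lam y * bump k (B6QGQLower276.chart k y.1 j) := by
    intro j
    rw [extB_of_mem _ (B4BoxCov237.finePt_mem_boxDom (k + 1) y.2 j)]
    simp only [testVec, F, Nat.add_sub_cancel, ← chart6_eq, B6QGQLower276.blk_chart]
    rw [extB_of_mem lam y.2]
  simp_rw [hpt]
  rw [← Finset.mul_sum, ← sum_B, sum_B_bump, mul_comm]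
  simp [ThetaB]

/-- `Σ_x λ(blkBox x)² = n^{d+1}·‖λ‖²`. [folklore] -/
theorem sum_lam_blkBox_sq {n : ℕ} (hn : 1 ≤ n) (M : Fin (d + 1) → ℕ) (lam : ↥(boxDom M) → ℝ) :
    ∑ x : ↥(boxDom (fineN n M)), lam (blkBox hn M x) ^ 2 = (n : ℝ) ^ (d + 1) * (lam ⬝ᵥ lam) := by
  rw [sum_comp_blkBox hn M fun y => lam y ^ 2]
  congr 1
  unfold dotProduct
  exact Finset.sum_congr rfl fun y _ => by ring

/-! ## §3 The energy of the test vector on the Neumann box -/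

/-- the in-box degree is at most `2(d+1)`. [folklore] -/
theorem card_boxNbrs_le (N : Fin (d + 1) → ℕ) (x : ↥(boxDom N)) : ((boxNbrs N x).card : ℝ) ≤ 2 * ((d : ℝ) + 1) := by
  have h : (boxNbrs N x).card ≤ 2 * (d + 1) := by
    rw [card_boxNbrs]
    exact (Finset.card_filter_le _ _).trans (card_nbrs x.1).le
  exact_mod_cast h

/-- **BOND ESTIMATE ON THE BOX**: for box neighbours `x ∼ y`, `(v_λ x − v_λ y)² ≤ 2(λ(blk x)² + λ(blk y)²)/n²`
(B6QGQLower276's `F_step_sq`, in either orientation of the bond). [folklore] -/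
theorem testVec_bond_sq {n : ℕ} (hn : 1 ≤ n) (M : Fin (d + 1) → ℕ) (lam : ↥(boxDom M) → ℝ)
    (x y : ↥(boxDom (fineN n M))) (hy : y ∈ boxNbrs (fineN n M) x) :
    (testVec n M lam x - testVec n M lam y) ^ 2
      ≤ 2 * (lam (blkBox hn M x) ^ 2 + lam (blkBox hn M y) ^ 2) / (n : ℝ) ^ 2 := by
  obtain ⟨k, rfl⟩ : ∃ k, n = k + 1 := ⟨n - 1, by omega⟩
  have hΛ : ∀ z : ↥(boxDom (fineN (k + 1) M)), extB M lam (B6QGQLower276.blk k z.1) = lam (blkBox hn M z) := by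
    intro z; rw [blk6_eq]; exact extB_of_mem lam (blkBox hn M z).2
  have hcast : ((k : ℝ) + 1) = ((k + 1 : ℕ) : ℝ) := by push_cast; ring
  have hv : ∀ z : ↥(boxDom (fineN (k + 1) M)), testVec (k + 1) M lam z = F k (extB M lam) z.1 := by
    intro z; simp only [testVec, Nat.add_sub_cancel]
  have hy' : y.1 ∈ nbrs x.1 := by
    unfold boxNbrs at hy
    simpa using hy
  obtain ⟨i, hi | hi⟩ := mem_nbrs.1 hy'
  · have h := F_step_sq k (extB M lam) x.1 i
    have he : x.1 + B6QGQLower276.e i = y.1 := by rw [hi]; rfl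
    rw [he, hΛ x, hΛ y, hcast] at h
    rw [hv x, hv y]
    exact h
  · have h := F_step_sq k (extB M lam) y.1 i
    have he : y.1 + B6QGQLower276.e i = x.1 := by
      rw [hi]; simp [B6QGQLower276.e]
    rw [he, hΛ x, hΛ y, hcast] at h
    rw [hv x, hv y]
    calc (F k (extB M lam) x.1 - F k (extB M lam) y.1) ^ 2
        = (F k (extB M lam) y.1 - F k (extB M lam) x.1) ^ 2 := by ring
      _ ≤ _ := h
      _ = _ := by ring

/-- **THE BOND SUM OF THE TEST VECTOR**: `Σ_x Σ_{y ∼ x} (v_λ x − v_λ y)² ≤ (8(d+1)/n²)·n^{d+1}‖λ‖²`. [folklore] -/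
theorem testVec_bondSum_le {n : ℕ} (hn : 1 ≤ n) (M : Fin (d + 1) → ℕ) (lam : ↥(boxDom M) → ℝ) :
    ∑ x, ∑ y ∈ boxNbrs (fineN n M) x, (testVec n M lam x - testVec n M lam y) ^ 2
      ≤ 8 * ((d : ℝ) + 1) / (n : ℝ) ^ 2 * ((n : ℝ) ^ (d + 1) * (lam ⬝ᵥ lam)) := by
  set A : ↥(boxDom (fineN n M)) → ℝ := fun z => 2 * lam (blkBox hn M z) ^ 2 / (n : ℝ) ^ 2 with hA
  have hA0 : ∀ z, 0 ≤ A z := fun z => by rw [hA]; positivity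
  have h1 : ∑ x, ∑ y ∈ boxNbrs (fineN n M) x, (testVec n M lam x - testVec n M lam y) ^ 2
      ≤ ∑ x, ∑ y ∈ boxNbrs (fineN n M) x, (A x + A y) := by
    refine Finset.sum_le_sum fun x _ => Finset.sum_le_sum fun y hy => ?_
    have := testVec_bond_sq hn M lam x y hy
    rw [hA]
    calc _ ≤ 2 * (lam (blkBox hn M x) ^ 2 + lam (blkBox hn M y) ^ 2) / (n : ℝ) ^ 2 := this
      _ = _ := by ring
  have h2 : ∑ x, ∑ y ∈ boxNbrs (fineN n M) x, (A x + A y) = 2 * ∑ x, ((boxNbrs (fineN n M) x).card : ℝ) * A x := by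
    have hswap : ∑ x, ∑ y ∈ boxNbrs (fineN n M) x, A y = ∑ x, ∑ y ∈ boxNbrs (fineN n M) x, A x :=
      sum_boxNbrs_commR (fun _ y => A y)
    simp only [Finset.sum_add_distrib, hswap, Finset.sum_const, nsmul_eq_mul]
    ring
  have h3 : ∑ x, ((boxNbrs (fineN n M) x).card : ℝ) * A x ≤ ∑ x, 2 * ((d : ℝ) + 1) * A x :=
    Finset.sum_le_sum fun x _ => mul_le_mul_of_nonneg_right (card_boxNbrs_le _ x) (hA0 x)
  have h4 : ∑ x, 2 * ((d : ℝ) + 1) * A x = 4 * ((d : ℝ) + 1) / (n : ℝ) ^ 2 * ((n : ℝ) ^ (d + 1) * (lam ⬝ᵥ lam)) := by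
    rw [← sum_lam_blkBox_sq hn M lam, Finset.mul_sum]
    refine Finset.sum_congr rfl fun x _ => ?_
    rw [hA]; ring
  calc _ ≤ ∑ x, ∑ y ∈ boxNbrs (fineN n M) x, (A x + A y) := h1
    _ = 2 * ∑ x, ((boxNbrs (fineN n M) x).card : ℝ) * A x := h2
    _ ≤ 2 * ∑ x, 2 * ((d : ℝ) + 1) * A x := by linarith [h3]
    _ = _ := by rw [h4]; ring

/-- the `ℓ²` mass of the test vector: `Σ_x v_λ(x)² ≤ n^{d+1}‖λ‖²`. [folklore] -/
theorem testVec_sq_sum_le {n : ℕ} (hn : 1 ≤ n) (M : Fin (d + 1) → ℕ) (lam : ↥(boxDom M) → ℝ) :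
    ∑ x, testVec n M lam x ^ 2 ≤ (n : ℝ) ^ (d + 1) * (lam ⬝ᵥ lam) := by
  rw [← sum_lam_blkBox_sq hn M lam]
  refine Finset.sum_le_sum fun x _ => ?_
  have h := abs_testVec_le hn M lam x
  rw [← sq_abs, ← sq_abs (lam _)]
  exact pow_le_pow_left₀ (abs_nonneg _) h 2

/-- the Gram part of the energy: `v_λ ⬝ (SᵀS) v_λ = Θ²‖λ‖²`. [folklore] -/
theorem testVec_gram_eq {n : ℕ} (hn : 1 ≤ n) (M : Fin (d + 1) → ℕ) (lam : ↥(boxDom M) → ℝ) :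
    testVec n M lam ⬝ᵥ (((indB n M)ᵀ * indB n M) *ᵥ testVec n M lam) = ThetaB d n ^ 2 * (lam ⬝ᵥ lam) := by
  rw [← Matrix.mulVec_mulVec, Matrix.dotProduct_mulVec, Matrix.vecMul_transpose, indB_mulVec_testVec hn,
    smul_dotProduct, dotProduct_smul, smul_eq_mul, smul_eq_mul]
  ring

/-- **THE ENERGY OF THE TEST VECTOR**: `v_λ ⬝ (boxOpR n a m² M) v_λ ≤ (4(d+1) + m² + a)·n^{d+1}·‖λ‖²` — the tapering of
the bump to `1/n` at the block faces makes the Dirichlet energy `O(n^{d+1})` (not `O(n^{d+2})` as for a block indicator).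
[folklore] -/
theorem testVec_energy_le {n : ℕ} (hn : 1 ≤ n) {a m2 : ℝ} (ha : 0 ≤ a) (hm : 0 ≤ m2) (M : Fin (d + 1) → ℕ)
    (lam : ↥(boxDom M) → ℝ) :
    testVec n M lam ⬝ᵥ (boxOpR n a m2 M *ᵥ testVec n M lam)
      ≤ (4 * ((d : ℝ) + 1) + m2 + a) * (n : ℝ) ^ (d + 1) * (lam ⬝ᵥ lam) := by
  set v := testVec n M lam with hv
  have hn0 : (0 : ℝ) < n := by exact_mod_cast hn
  have hN : (0 : ℝ) < (n : ℝ) ^ (d + 1) := by positivity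
  have hll : 0 ≤ lam ⬝ᵥ lam := Finset.sum_nonneg fun i _ => mul_self_nonneg _
  -- the free part (`a = 0`): bond sum + mass
  have hfree : v ⬝ᵥ (boxOpR n 0 m2 M *ᵥ v) ≤ (4 * ((d : ℝ) + 1) + m2) * (n : ℝ) ^ (d + 1) * (lam ⬝ᵥ lam) := by
    rw [show boxOpR n 0 m2 M = opBoxR ((n : ℝ) ^ 2) m2 (0 * ((n : ℝ) ^ (d + 1))⁻¹) n (fineN n M) from rfl,
      quadFormR_eq, zero_mul, zero_mul, add_zero]
    have hb := testVec_bondSum_le hn M lam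
    have hm2 := testVec_sq_sum_le hn M lam
    have e1 : (n : ℝ) ^ 2 / 2 * (8 * ((d : ℝ) + 1) / (n : ℝ) ^ 2 * ((n : ℝ) ^ (d + 1) * (lam ⬝ᵥ lam)))
        = 4 * ((d : ℝ) + 1) * (n : ℝ) ^ (d + 1) * (lam ⬝ᵥ lam) := by
      field_simp; ring
    calc (n : ℝ) ^ 2 / 2 * (∑ x, ∑ y ∈ boxNbrs (fineN n M) x, (v x - v y) ^ 2) + m2 * ∑ x, v x ^ 2
        ≤ (n : ℝ) ^ 2 / 2 * (8 * ((d : ℝ) + 1) / (n : ℝ) ^ 2 * ((n : ℝ) ^ (d + 1) * (lam ⬝ᵥ lam)))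
          + m2 * ((n : ℝ) ^ (d + 1) * (lam ⬝ᵥ lam)) :=
          add_le_add (mul_le_mul_of_nonneg_left hb (by positivity)) (mul_le_mul_of_nonneg_left hm2 hm)
      _ = _ := by rw [e1]; ring
  -- the block part: `(a/N)·Θ²‖λ‖² ≤ a·N·‖λ‖²`
  have hΘ : ThetaB d n ^ 2 ≤ ((n : ℝ) ^ (d + 1)) ^ 2 :=
    pow_le_pow_left₀ (ThetaB_pos hn).le (ThetaB_le hn) 2
  rw [boxOpR_eq_add_gram hn a m2 M, Matrix.add_mulVec, dotProduct_add, Matrix.smul_mulVec, dotProduct_smul,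
    smul_eq_mul, testVec_gram_eq hn]
  have hblock : a * ((n : ℝ) ^ (d + 1))⁻¹ * (ThetaB d n ^ 2 * (lam ⬝ᵥ lam)) ≤ a * (n : ℝ) ^ (d + 1) * (lam ⬝ᵥ lam) := by
    have : a * ((n : ℝ) ^ (d + 1))⁻¹ * (ThetaB d n ^ 2 * (lam ⬝ᵥ lam))
        ≤ a * ((n : ℝ) ^ (d + 1))⁻¹ * (((n : ℝ) ^ (d + 1)) ^ 2 * (lam ⬝ᵥ lam)) :=
      mul_le_mul_of_nonneg_left (mul_le_mul_of_nonneg_right hΘ hll) (by positivity)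
    refine this.trans (le_of_eq ?_)
    field_simp
  calc v ⬝ᵥ (boxOpR n 0 m2 M *ᵥ v) + a * ((n : ℝ) ^ (d + 1))⁻¹ * (ThetaB d n ^ 2 * (lam ⬝ᵥ lam))
      ≤ (4 * ((d : ℝ) + 1) + m2) * (n : ℝ) ^ (d + 1) * (lam ⬝ᵥ lam) + a * (n : ℝ) ^ (d + 1) * (lam ⬝ᵥ lam) :=
        add_le_add hfree hblock
    _ = _ := by ring

/-! ## §4 The variational lower bound: `S G Sᵀ ⪰ n^{d+1}γ_B`, `Q_kG_k(□)Q_k^* ⪰ γ_B` -/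

/-- weakening the constant of a coercivity statement. [folklore] -/
theorem coercive_mono {m : Type*} [Fintype m] {T : Matrix m m ℝ} {γ γ' : ℝ} (h : QGQInverse.Coercive T γ)
    (hle : γ' ≤ γ) : QGQInverse.Coercive T γ' := fun x =>
  (mul_le_mul_of_nonneg_right hle (Finset.sum_nonneg fun i _ => mul_self_nonneg (x i))).trans (h x)

/-- scaling a coercivity statement by a nonnegative scalar. [folklore] -/
theorem coercive_smul {m : Type*} [Fintype m] {T : Matrix m m ℝ} {γ c : ℝ} (h : QGQInverse.Coercive T γ)
    (hc : 0 ≤ c) : QGQInverse.Coercive (c • T) (c * γ) := fun x => by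
  rw [Matrix.smul_mulVec, dotProduct_smul, smul_eq_mul, mul_assoc]
  exact mul_le_mul_of_nonneg_left (h x) hc

/-- **`S·G·Sᵀ ⪰ n^{d+1}·γ_B`** (`G = (boxOpR n a m² M)⁻¹`, `S = indB n M`, `γ_B = gammaQ (d+1) (m² + a)`): the variational
inequality `QGQInverse.qgq_coercive_of_approx_right_inverse` fed with the normalised bump test vector `Θ⁻¹·v_λ`
(exact right inverse: `S(Θ⁻¹v_λ) = λ`; energy `≤ Θ⁻²(4(d+1) + m² + a)n^{d+1}‖λ‖²`) and `Θ ≥ (n/6)^{d+1}`. [folklore] -/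
theorem sGs_coercive {n : ℕ} (hn : 1 ≤ n) {a m2 : ℝ} (ha : 0 < a) (hm : 0 ≤ m2) {M : Fin (d + 1) → ℕ}
    (hM : ∀ i, 1 ≤ M i) :
    QGQInverse.Coercive (indB n M * (boxOpR n a m2 M)⁻¹ * (indB n M)ᵀ)
      ((n : ℝ) ^ (d + 1) * gammaQ (d + 1) (m2 + a)) := by
  set Θ := ThetaB d n with hΘdef
  set B := 4 * ((d : ℝ) + 1) + m2 + a with hB
  have hn0 : (0 : ℝ) < n := by exact_mod_cast hn
  have hN : (0 : ℝ) < (n : ℝ) ^ (d + 1) := by positivity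
  have hΘ : 0 < Θ := ThetaB_pos hn
  have hB0 : 0 < B := by rw [hB]; positivity
  have hC : 0 < (Θ ^ 2)⁻¹ * (B * (n : ℝ) ^ (d + 1)) := by positivity
  have hcoer := QGQInverse.qgq_coercive_of_approx_right_inverse (boxOpR n a m2 M) (boxOpR_isSymm n a m2 M)
    (boxOpR_isUnit hn ha hm hM) (boxOpR_form_nonneg n ha.le hm M) (indB n M) hC (θ := 0) (by norm_num)
    (fun lam => Θ⁻¹ • testVec n M lam) ?_ ?_
  · refine coercive_mono hcoer ?_
    -- `N·γ_B ≤ (1 − 0)²/(Θ⁻²·B·N) = Θ²/(B·N)`, from `Θ ≥ N/6^{d+1}`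
    have hΘge : (n : ℝ) ^ (d + 1) / 6 ^ (d + 1) ≤ Θ := by rw [← div_pow]; exact ThetaB_ge hn
    have h36 : ((36 : ℝ)) ^ (d + 1) = ((6 : ℝ) ^ (d + 1)) ^ 2 := by
      rw [← pow_mul, mul_comm, pow_mul]; norm_num
    have hsq : ((n : ℝ) ^ (d + 1)) ^ 2 / 36 ^ (d + 1) ≤ Θ ^ 2 := by
      rw [h36, ← div_pow]; exact pow_le_pow_left₀ (by positivity) hΘge 2
    have hγ : gammaQ (d + 1) (m2 + a) = 1 / (36 ^ (d + 1) * B) := by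
      simp only [gammaQ, hB]; push_cast; ring
    rw [hγ, sub_zero, one_pow]
    rw [div_le_iff₀ (by positivity)] at hsq
    rw [one_div, le_div_iff₀ hC]
    calc (n : ℝ) ^ (d + 1) * (36 ^ (d + 1) * B)⁻¹ * ((Θ ^ 2)⁻¹ * (B * (n : ℝ) ^ (d + 1)))
        = (((n : ℝ) ^ (d + 1)) ^ 2 / 36 ^ (d + 1)) * (Θ ^ 2)⁻¹ := by field_simp
      _ ≤ (Θ ^ 2 * 1) * (Θ ^ 2)⁻¹ := by
          refine mul_le_mul_of_nonneg_right ?_ (by positivity)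
          rw [mul_one]; rw [div_le_iff₀ (by positivity)]; exact hsq
      _ = 1 := by field_simp
  · intro lam
    rw [Matrix.mulVec_smul, indB_mulVec_testVec hn, smul_smul, ← hΘdef, inv_mul_cancel₀ hΘ.ne', one_smul, sub_zero,
      one_mul]
  · intro lam
    have hE := testVec_energy_le hn ha.le hm M lam
    rw [← hB] at hE
    rw [Matrix.mulVec_smul, dotProduct_smul, smul_dotProduct, smul_eq_mul, smul_eq_mul]
    have hll : 0 ≤ lam ⬝ᵥ lam := Finset.sum_nonneg fun i _ => mul_self_nonneg _
    calc Θ⁻¹ * (Θ⁻¹ * (testVec n M lam ⬝ᵥ (boxOpR n a m2 M *ᵥ testVec n M lam)))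
        ≤ Θ⁻¹ * (Θ⁻¹ * (B * (n : ℝ) ^ (d + 1) * (lam ⬝ᵥ lam))) :=
          mul_le_mul_of_nonneg_left (mul_le_mul_of_nonneg_left hE (by positivity)) (by positivity)
      _ = (Θ ^ 2)⁻¹ * (B * (n : ℝ) ^ (d + 1)) * (lam ⬝ᵥ lam) := by field_simp

/-- **BAŁABAN'S BLOCK-AVERAGED BOX PROPAGATOR IS UNIFORMLY COERCIVE**: `Q_kG_k(□)Q_k^* = n^{−(d+1)}·S·G·Sᵀ ⪰ γ_B·1` with
`γ_B = 1/(36^{d+1}(4(d+1) + m² + a))` for EVERY `n ≥ 1`, every box of unit blocks and every `a > 0`, `m² ≥ 0` — the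
Neumann-box, `A = 0` counterpart of B6 (2.76) «Q′_jG′_jQ′_j* ≥ 2γ₀» [Balaban1984PropagatorsII, p. 236] (tree, whole
lattice: `B6QGQLower276.qGq_lower`, same constant), used here only as the located analogue; nothing printed is a
hypothesis. [folklore] -/
theorem qGq_box_coercive {n : ℕ} (hn : 1 ≤ n) {a m2 : ℝ} (ha : 0 < a) (hm : 0 ≤ m2) {M : Fin (d + 1) → ℕ}
    (hM : ∀ i, 1 ≤ M i) :
    QGQInverse.Coercive ((((n : ℝ) ^ (d + 1))⁻¹) • (indB n M * (boxOpR n a m2 M)⁻¹ * (indB n M)ᵀ))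
      (gammaQ (d + 1) (m2 + a)) := by
  have hn0 : (0 : ℝ) < n := by exact_mod_cast hn
  have hN : (0 : ℝ) < (n : ℝ) ^ (d + 1) := by positivity
  have h := coercive_smul (sGs_coercive hn ha hm hM) (inv_nonneg.2 hN.le)
  rwa [← mul_assoc, inv_mul_cancel₀ hN.ne', one_mul] at h

end
end Summit.QuantumFields.BalabanUV.Beta.GAN24.WoodburyFibreBoxQGQ
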